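import Summits.QuantumFields.BalabanUV.T4Continuum.Support.ShellMeasureHistoriesTransportIterate

/-!
# `T4Continuum.ShellMeasureHistoriesTransportSU` — row S103a f3: THE TRANSPORT IDENTIFICATION IS KERNEL FOR BAŁABAN's `SU(N)` BLOCK
# AVERAGING TOWER — the finite tower of f2 INSTANTIATED at the tree's `towerMap` of `avgFun expMeanLogSU` (every step's `HaarAC`
# is the tree's THEOREM `haarAC_avgFun_expMeanLogSU_SUN` in the standing range `lvl + M ≤ P.m + P.K`)
(cell `pub-balaban`, sub-cell `t4`, spine estimate NE7c (node U5b); NE7c ROUND-2 crew, unit `b2b-balaban-t4-ne7c-formalise-leaf-08`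
gen 16; owner table row **S103a** (R-ne7cp1-g35-6 (a) ∕ R-ne7cp1-g36-1 (a)); file 3 — the instantiation sentence of leaf-03-g8's XREAD
C-ne7cleaf03g8-4 (journal `CLAIMS.log` l.21313: «the tree's `towerMap`∕`towerAC`∕`towerAC_expMeanLogSU_SUN` inhabit f2's `π`∕`hπ0`∕`hπs`∕`hac`
one line each») made a named theorem, so that R-ne7cp1-g35-6 (b)'s «[K] if `π` is the tree's DEFINED iterated block averaging» holds BY
NAME for `SU(N)`, every `N ≥ 1`; imports f2 `ShellMeasureHistoriesTransportIterate` ONLY; [folklore]; 0 `def`, 0 `def … : Prop`, 0 sorry,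
0 citation tags)

HONEST FRAMING.  Finite four-torus programme, rung (B)+1 only — NOT infinite volume, NOT a mass gap, NOT the Clay problem, NOT
summit progress; (B), `BetaPertHyp`, (B^μ) not consumed.  NE7c NOT PRINTED, NOT PROVED; «NE7c ⇐ the named binders» (c3).  Plumbing on
OUR side: f2's def-free tower fed with the Literature unit's DEFINED objects (`T4AveragingDisintegration.towerMap`, `BlockAveraging.avgFun`,
`ExpMeanLog.expMeanLogSU` — the cell's typed reading of [Balaban1985Averaging] (0.4), locator only) and its THEOREMS (`measurable_avgFun`,
`haarAC_avgFun_expMeanLogSU_SUN`); nothing of Bałaban's is asserted or discharged; NOTHING in the countdown moves.  HONEST DEPENDENCY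
(cell): continuum YM on T⁴ ⇐ BetaPertH ∧ nine spine estimates (0/9 proved); BetaPertH ⇐ (D1) ∧ (D4) ∧ CAP+tail; G-an2-4 gates asym, D1 and
NE2/3/4.

CONTENT.
* `map_withDensity_tower_SUN` — for `G = SU(N)`, a base level `lvl` and `M` steps in the standing range (`lvl + M ≤ P.m + P.K`), and a
  family `ρ m : GaugeField P (lvl + m) (SU N) → ℝ` with `ρ (m+1) = kernelTransport (fieldMeasure_{lvl+m}) (fieldMeasure_{lvl+m+1}) avgFun (ρ m)`
  from a nonnegative integrable `ρ 0`: for every `m ≤ M`,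
  `((fieldMeasure P lvl (SU N)).withDensity (ofReal ∘ ρ 0)).map (towerMap avgFun lvl m) = (fieldMeasure P (lvl+m) (SU N)).withDensity (ofReal ∘ ρ m)`
  — NO absolute-continuity hypothesis left (every step's `HaarAC` is the tree's theorem).
* `slotAntiConcentration_histLaw_of_tower_SUN` — hence, for a history's law `histLaw ((fieldMeasure P lvl (SU N)).withDensity (ofReal ∘ h)) sm u ϑ`
  and a slot read on layer `lvl + m` (`u s = u' ∘ towerMap avgFun lvl m`), (M1) on the layer ⟹ (M1) for the history's law along `u s`,
  SAME `θ ρ D` — the ONLY remaining non-kernel sentence is the READING (class O).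
NOT HERE: the choice of `h` (the history's sectioned density) and of `u'` (the layer classifier) — node O ∕ row S103b.
-/

noncomputable section

open MeasureTheory Set

namespace Summit.QuantumFields.BalabanUV.T4Continuum.ShellMeasureHistoriesTransportSU

open scoped ENNReal
open Literature.MathematicalPhysics.QuantumFieldTheory.Balaban1983to89
open T4ShellMeasure (SlotAntiConcentration)
open T4FiniteEpsInhabited (HaarAC)
open BlockAveraging (avgFun measurable_avgFun)
open ExpMeanLog (expMeanLogSU measurable_expMeanLogSU_E)
open BlockAveragingEMLFibreLawSUN (haarAC_avgFun_expMeanLogSU_SUN)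
open T4AveragingDisintegration (SU kernelTransport towerMap towerMap_zero towerMap_succ)
open ShellMeasureHistoriesTransportIterate (map_withDensity_tower slotAntiConcentration_histLaw_of_tower)

variable {N : ℕ} [NeZero N] {P : Params}

/-- **THE TRANSPORT IDENTIFICATION ALONG BAŁABAN's `SU(N)` AVERAGING TOWER — KERNEL, NO A.C. HYPOTHESIS.**  f2
`map_withDensity_tower` at `β m := GaugeField P (lvl + m) (SU N)`, `ν m := fieldMeasure P (lvl + m) (SU N)`, `avg m := avgFun expMeanLogSU`,
`π := towerMap avgFun lvl` (`towerMap_zero`, `towerMap_succ` by `rfl`), each step's a.c. `= haarAC_avgFun_expMeanLogSU_SUN` (needs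
`lvl + m + 1 ≤ P.m + P.K`, i.e. `m < M` with `lvl + M ≤ P.m + P.K`). [folklore] -/
theorem map_withDensity_tower_SUN (lvl M : ℕ) (hM : lvl + M ≤ P.m + P.K)
    (ρ : ∀ m, GaugeField P (lvl + m) (SU N) → ℝ)
    (hρs : ∀ m < M, ρ (m + 1) = kernelTransport (fieldMeasure P (lvl + m) (SU N)) (fieldMeasure P (lvl + m + 1) (SU N))
      (avgFun (expMeanLogSU : LoopAverage (SU N)) : GaugeField P (lvl + m) (SU N) → GaugeField P (lvl + m + 1) (SU N)) (ρ m))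
    (hρ0i : Integrable (ρ 0) (fieldMeasure P lvl (SU N))) (hρ00 : ∀ x, 0 ≤ ρ 0 x) :
    ∀ m ≤ M, (∀ x, 0 ≤ ρ m x) ∧ Integrable (ρ m) (fieldMeasure P (lvl + m) (SU N)) ∧
      Measurable (towerMap (fun j => (avgFun (expMeanLogSU : LoopAverage (SU N)) :
        GaugeField P j (SU N) → GaugeField P (j+1) (SU N))) lvl m) ∧
      ((fieldMeasure P lvl (SU N)).withDensity fun x => ENNReal.ofReal (ρ 0 x)).map
          (towerMap (fun j => (avgFun (expMeanLogSU : LoopAverage (SU N)) :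
            GaugeField P j (SU N) → GaugeField P (j+1) (SU N))) lvl m) =
        (fieldMeasure P (lvl + m) (SU N)).withDensity fun x => ENNReal.ofReal (ρ m x) :=
  map_withDensity_tower (β := fun m => GaugeField P (lvl + m) (SU N)) (fun m => fieldMeasure P (lvl + m) (SU N))
    (fun m => (avgFun (expMeanLogSU : LoopAverage (SU N)) : GaugeField P (lvl + m) (SU N) → GaugeField P (lvl + m + 1) (SU N)))
    (M := M) (fun m _ => measurable_avgFun _ measurable_expMeanLogSU_E)
    (fun m hm => haarAC_avgFun_expMeanLogSU_SUN (by omega))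
    (towerMap (fun j => (avgFun (expMeanLogSU : LoopAverage (SU N)) : GaugeField P j (SU N) → GaugeField P (j+1) (SU N))) lvl)
    (towerMap_zero _ _) (fun m _ => rfl) ρ hρs hρ0i hρ00

/-- **(M1) FOR A HISTORY's LAW OVER THE FINEST `SU(N)` LAYER FROM (M1) ON BAŁABAN's LAYER `lvl + m`, KERNEL UP TO THE READING.**
f2 `slotAntiConcentration_histLaw_of_tower` on the `SU(N)` averaging tower: history density `h ≥ 0` measurable with
`ρ 0 = h · smallProd`, `ρ (m+1) = kernelTransport … (ρ m)`, reading `u s = u' ∘ towerMap avgFun lvl m` ([dict], B14 (2.16) TYPE —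
the ONLY non-kernel sentence), (M1) on layer `lvl + m` for `(fieldMeasure P (lvl+m) (SU N)).withDensity (ofReal ∘ ρ m)` along `u'`
⟹ (M1) for `histLaw ((fieldMeasure P lvl (SU N)).withDensity (ofReal ∘ h)) sm u ϑ` along `u s`, SAME `θ ρ' D`. [folklore] -/
theorem slotAntiConcentration_histLaw_of_tower_SUN {σ : Type*} (lvl M : ℕ) (hM : lvl + M ≤ P.m + P.K)
    {h : GaugeField P lvl (SU N) → ℝ} (hh0 : ∀ x, 0 ≤ h x) (hhm : Measurable h) (sm : Finset σ)
    {u : σ → GaugeField P lvl (SU N) → ℝ} (hu : ∀ s, Measurable (u s)) (ϑ : σ → ℝ)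
    (ρ : ∀ m, GaugeField P (lvl + m) (SU N) → ℝ)
    (hρ0 : ρ 0 = fun x => h x * ShellMeasureRootCompositionHistories.smallProd sm u ϑ x)
    (hρs : ∀ m < M, ρ (m + 1) = kernelTransport (fieldMeasure P (lvl + m) (SU N)) (fieldMeasure P (lvl + m + 1) (SU N))
      (avgFun (expMeanLogSU : LoopAverage (SU N)) : GaugeField P (lvl + m) (SU N) → GaugeField P (lvl + m + 1) (SU N)) (ρ m))
    (hρ0i : Integrable (ρ 0) (fieldMeasure P lvl (SU N)))
    {m : ℕ} (hm : m ≤ M) {s : σ} {u' : GaugeField P (lvl + m) (SU N) → ℝ}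
    (hread : u s = u' ∘ towerMap (fun j => (avgFun (expMeanLogSU : LoopAverage (SU N)) :
      GaugeField P j (SU N) → GaugeField P (j+1) (SU N))) lvl m)
    {θ ρ' D : ℝ}
    (hlay : SlotAntiConcentration ((fieldMeasure P (lvl + m) (SU N)).withDensity fun x => ENNReal.ofReal (ρ m x)) u' θ ρ' D) :
    SlotAntiConcentration
      (ShellMeasureRootCompositionHistories.histLaw ((fieldMeasure P lvl (SU N)).withDensity fun x => ENNReal.ofReal (h x)) sm u ϑ)
      (u s) θ ρ' D :=
  slotAntiConcentration_histLaw_of_tower (β := fun m => GaugeField P (lvl + m) (SU N))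
    (fun m => fieldMeasure P (lvl + m) (SU N))
    (fun m => (avgFun (expMeanLogSU : LoopAverage (SU N)) : GaugeField P (lvl + m) (SU N) → GaugeField P (lvl + m + 1) (SU N)))
    (M := M) (fun m _ => measurable_avgFun _ measurable_expMeanLogSU_E)
    (fun m hm => haarAC_avgFun_expMeanLogSU_SUN (by omega))
    (towerMap (fun j => (avgFun (expMeanLogSU : LoopAverage (SU N)) : GaugeField P j (SU N) → GaugeField P (j+1) (SU N))) lvl)
    (towerMap_zero _ _) (fun m _ => rfl) hh0 hhm sm hu ϑ ρ hρ0 hρs hρ0i hm hread hlay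

end Summit.QuantumFields.BalabanUV.T4Continuum.ShellMeasureHistoriesTransportSU

end
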